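import Summits.BirchSwinnertonDyer.BirchSwinnertonDyer.Theorems.ByReductionTypeAtTwoSupersingularFlatAnnihilatorDivisible
import Literature.Algebra.Module.PadicPairingFamilies
import Literature.Algebra.Module.PadicFunctionalSeparation
import Mathlib.Algebra.Module.CharacterModule
import HarnessLib

/-!
# `Ker Col⋆` for EITHER colour `⋆ ∈ {♯, ♭}`: twist-saturated, closed, equal to its double annihilator, and
# `(E⋆_{∞,𝔭})_Γ = 0` in pair form — the colour-generic form of parts 16–18 of the bsd-2adic COUNT♭@2 series

Cell `bsd-inputs` (D-0154 (2) INPUTS→UNCONDITIONAL), seat `bsd-inputs-l55-p1`; serves item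
stmt-BirchSwinnertonDyer-19878 (`Sprung2024.lem59AllN_sharpFlatCharValue_rankZero`) through its single residual
`Sprung2024.lem55AllN_sharpFlat_coinvariants_card` (Sprung 2024 §5.2 Lemma 5.5, BOTH colours). The odd-`p` door
`SharpFlatCount.sharpFlatCount_of_print_of_locp` (file `…SharpFlatCharValueRankZeroAllLevelsCount.lean`) displays
the `⋆`-local lift at the place above `p`; for `⋆ = ♭` it is the bsd-2adic part 19
(`SSFlatEC.exists_localLift_flat`), which rests on parts 16–18 (`…FlatKernelClosed`, `…FlatKernelBidual`,
`…FlatAnnihilatorDivisible`), all written for `Ker Col♭` only. Their proofs are colour-blind (Sprung's Coleman map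
is the PAIR `(Col♯, Col♭)`; uniqueness, twisting `Col(z∘g⁻¹) = (1+T)·Col(z)` and the continuity estimate
`Sprung2017.IsChromaticLimit.pow_dvd_coeff_flat/_sharp` hold componentwise). THIS FILE re-proves them for a
colour variable `col`, VERBATIM up to the projection `chromaticL col`:

* §1 `mem_colemanKer_of_twist_sub_mem`, `mem_colemanKer_twist_iff` — `Ker Col⋆` is twist-saturated / twist-stable
  (part 16 §1);
* §2 `mem_colemanKer_of_forall_exists_agree` — `Ker Col⋆` is closed in the finite topology (part 16 §3);
* §3 `mem_colemanKer_of_forall_annihilator_dvd` — `(Ker Col⋆)^⊥⊥ = Ker Col⋆` (part 17 §2, with part 17 §1's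
  finite-level duality `SSFlatEC.exists_mem_forall_dvd_sub_of_forall_comb_dvd` reused as is);
* §4 `annihilator_twist_divisible` — `(E⋆_{∞,𝔭})_Γ = 0` in pair form (part 18).

Hypotheses as in the bsd-2adic parts: `p ∣ a_p`, a local `g` restricting to a topological generator, levels
`c_n ∈ E(K_n·K_v)`, the `n ≥ 1` trace relation (and no `p`-torsion in `E(K_∞·K_v)` for §4); any number field,
any completion, any `p`, either colour. HONEST FRAMING: kernel algebra on the tree's transcription
(`Sprung2012/ColemanMaps.lean`); theorems only; nothing about any curve is asserted; item 19878 is not closed by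
this file; no census cell moves; BSD is not proved by any of this.

References: [Sprung2012] F. Sprung, J. Number Theory 132 (2012), Def. 3.1, Prop. 5.7, Lemma 5.8, Def. 5.9,
Def. 7.1, Def. 7.9–7.11 (pp. 1489–1503), §2 p. 1486; [Sprung2017] Thm. 1.12; [GreenbergLNM1716] §4 proof of
Lemma 4.7, p. 108; [NeukirchSchmidtWingberg2008] I §1 (1.1.8).
-/

set_option autoImplicit false
-- the Theorems namespace of this sub repeats the summit name by design (D-0017 nested layout)
set_option linter.dupNamespace false

noncomputable section

open scoped Classical NumberField

open NumberField IsDedekindDomain Polynomial WeierstrassCurve Literature.NumberTheory.EllipticCurves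
  Literature.NumberTheory.GaloisRepresentations Literature.NumberTheory.EllipticCurves.ZpExtension
  Literature.NumberTheory.EllipticCurves.Kobayashi2003 Literature.NumberTheory.EllipticCurves.Sprung2017
  Literature.NumberTheory.EllipticCurves.Sprung2012 Literature.Algebra.Module
  Summit.BirchSwinnertonDyer.BirchSwinnertonDyer.Theorems.SSFlatEC

universe u

namespace Summit.BirchSwinnertonDyer.BirchSwinnertonDyer.Theorems.SharpFlatCount

variable {K : Type u} [Field K] {p : ℕ} [Fact p.Prime] (κ : ZpExtension K p)
variable {E : Type u} [Field E] [Algebra K E] (ι : AlgebraicClosure K →ₐ[K] AlgebraicClosure E)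
variable (W : WeierstrassCurve K)

/-! ## §0 The projection `chromaticL col` is additive and `Λ`-homogeneous -/

/-- `chromaticL col` commutes with a common scalar factor. [cite: Sprung2017, Thm. 1.12 (notation)] -/
theorem chromaticL_mul_mul (col : Chroma) (a Ls Lf : IwasawaAlgebra p) :
    chromaticL col (a * Ls) (a * Lf) = a * chromaticL col Ls Lf := by
  cases col <;> rfl

/-- `chromaticL col` is additive. [cite: Sprung2017, Thm. 1.12 (notation)] -/
theorem chromaticL_add_add (col : Chroma) (Ls Lf Ls' Lf' : IwasawaAlgebra p) :
    chromaticL col (Ls + Ls') (Lf + Lf') = chromaticL col Ls Lf + chromaticL col Ls' Lf' := by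
  cases col <;> rfl

/-- `chromaticL col` is compatible with subtraction. [cite: Sprung2017, Thm. 1.12 (notation)] -/
theorem chromaticL_sub_sub (col : Chroma) (Ls Lf Ls' Lf' : IwasawaAlgebra p) :
    chromaticL col (Ls - Ls') (Lf - Lf') = chromaticL col Ls Lf - chromaticL col Ls' Lf' := by
  cases col <;> rfl

/-- A power of `p` dividing both components divides `chromaticL col`. [cite: Sprung2017, Thm. 1.12 (notation)] -/
theorem dvd_coeff_chromaticL (col : Chroma) {Ls Lf : IwasawaAlgebra p} {d : ℤ_[p]} {i : ℕ}
    (hf : d ∣ PowerSeries.coeff i Lf) (hs : d ∣ PowerSeries.coeff i Ls) :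
    d ∣ PowerSeries.coeff i (chromaticL col Ls Lf) := by
  cases col
  · exact hs
  · exact hf

/-! ## §1 `Ker Col⋆` is twist-saturated and twist-stable (either colour) -/

/-- **Twist-saturation of `Ker Col⋆`** (part 16 §1 for either colour). If `z ∘ g⁻¹ − z` ("`(γ−1)·z`") lies in
`Ker Col⋆`, so does `z`: `Col(z ∘ g⁻¹ − z) = T·Col(z)` (`IsColemanPair.twist_sub`), Coleman values are unique
(Prop. 5.7, `p ∣ a_p`), so `T·Col⋆(z) = 0`, whence `Col⋆(z) = 0` in the domain `Λ`.
[cite: Sprung2012, Def. 5.9, Prop. 5.7 (pp. 1494–1495), Def. 7.9 (p. 1503), §2 p. 1486 (T = γ − 1)] -/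
theorem mem_colemanKer_of_twist_sub_mem {ap : ℤ} (hap : (p : ℤ) ∣ ap)
    {g : Field.absoluteGaloisGroup E} (hg : κ.IsTopGenerator (resGalOfEmb ι g))
    {c : ℕ → localPoints W E} (hc : ∀ n, c n ∈ localLayerPointsOfEmb κ ι W n)
    (hTr : ∀ n, 1 ≤ n → localTraceOfEmb κ ι W n (n + 1) (c (n + 1)) = ap • c n - c (n - 1))
    (col : Chroma) {z z' : localTowerPointsOfEmb κ ι W →+ ℤ_[p]}
    (hz' : ∀ y : localTowerPointsOfEmb κ ι W,
      z' y = z ⟨g⁻¹ • (y : localPoints W E), smul_mem_localTowerPointsOfEmb κ ι W g⁻¹ y.2⟩)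
    (h : z' - z ∈ colemanKer κ ι W ap g c col) : z ∈ colemanKer κ ι W ap g c col := by
  obtain ⟨Ls, Lf, hz⟩ := exists_isColemanPair_of_trace κ ι W hg hap hc hTr z
  obtain ⟨a, b, hab, hb⟩ := h
  obtain ⟨h1, h2⟩ := (hz.twist_sub κ ι W hg hc hz').unique κ ι W hap hab
  have h0 : PowerSeries.X * chromaticL col Ls Lf = 0 := by
    rw [← chromaticL_mul_mul, h1, h2]; exact hb
  exact ⟨Ls, Lf, hz, (mul_eq_zero.mp h0).resolve_left PowerSeries.X_ne_zero⟩

/-- **`Ker Col⋆` is twist-stable**: `z ∈ Ker Col⋆ ↔ z ∘ g⁻¹ ∈ Ker Col⋆` (`Col(z ∘ g⁻¹) = (1+T)·Col(z)`,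
`IsColemanPair.twist`, and `1 + T ≠ 0`); part 16 §1 for either colour.
[cite: Sprung2012, Def. 5.9 (p. 1495) and §2 p. 1486 (γ ↦ 1 + X)] -/
theorem mem_colemanKer_twist_iff {ap : ℤ} (hap : (p : ℤ) ∣ ap)
    {g : Field.absoluteGaloisGroup E} (hg : κ.IsTopGenerator (resGalOfEmb ι g))
    {c : ℕ → localPoints W E} (hc : ∀ n, c n ∈ localLayerPointsOfEmb κ ι W n)
    (hTr : ∀ n, 1 ≤ n → localTraceOfEmb κ ι W n (n + 1) (c (n + 1)) = ap • c n - c (n - 1))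
    (col : Chroma) {z z' : localTowerPointsOfEmb κ ι W →+ ℤ_[p]}
    (hz' : ∀ y : localTowerPointsOfEmb κ ι W,
      z' y = z ⟨g⁻¹ • (y : localPoints W E), smul_mem_localTowerPointsOfEmb κ ι W g⁻¹ y.2⟩) :
    z' ∈ colemanKer κ ι W ap g c col ↔ z ∈ colemanKer κ ι W ap g c col := by
  obtain ⟨Ls, Lf, hz⟩ := exists_isColemanPair_of_trace κ ι W hg hap hc hTr z
  have htw := hz.twist κ ι W hg hc hz'
  constructor
  · rintro ⟨a, b, hab, hb⟩
    obtain ⟨h1, h2⟩ := htw.unique κ ι W hap hab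
    have h1X : (1 + PowerSeries.X : IwasawaAlgebra p) ≠ 0 := by
      intro h0
      have := congrArg PowerSeries.constantCoeff h0
      rw [map_add, map_one, PowerSeries.constantCoeff_X, add_zero, map_zero] at this
      exact one_ne_zero this
    have h0 : (1 + PowerSeries.X) * chromaticL col Ls Lf = 0 := by
      rw [← chromaticL_mul_mul, h1, h2]; exact hb
    exact ⟨Ls, Lf, hz, (mul_eq_zero.mp h0).resolve_left h1X⟩
  · rintro ⟨a, b, hab, hb⟩
    obtain ⟨h1, h2⟩ := hz.unique κ ι W hap hab
    refine ⟨(1 + PowerSeries.X) * Ls, (1 + PowerSeries.X) * Lf, htw, ?_⟩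
    rw [chromaticL_mul_mul, h1, h2, hb, mul_zero]

/-! ## §2 `Ker Col⋆` is closed in the finite topology (either colour) -/

/-- **`Ker Col⋆` is CLOSED** (part 16 §3 for either colour). Let `z` be a functional on `E(K_∞·K_v)` such that
for every `n, k` there is `z' ∈ Ker Col⋆` with `z ≡ z'` modulo `p^k` on the finite set
`{gʲ c_m : m ∈ {n, n+1}, j < p^m}`. Then `z ∈ Ker Col⋆`: `z − z'` has Coleman value `Col(z) − Col(z')` with
vanishing `⋆`-component of `Col(z')`, so by the continuity estimate (`SSFlatEC.pow_dvd_coeff_flat_of_dvd_evalOn`,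
both components) `p^{min(k, ⌊n/2⌋ − i)} ∣ Col⋆(z)_i`; with `n = 2(i + k)` every coefficient of `Col⋆(z)` is
divisible by every `p^k`, hence `Col⋆(z) = 0`.
[cite: Sprung2012, Prop. 5.7 and Lemma 5.8 («⋂ M_n = 0», pp. 1494–1495), Def. 7.9 (p. 1503)] -/
theorem mem_colemanKer_of_forall_exists_agree {ap : ℤ} (hap : (p : ℤ) ∣ ap)
    {g : Field.absoluteGaloisGroup E} (hg : κ.IsTopGenerator (resGalOfEmb ι g))
    {c : ℕ → localPoints W E} (hc : ∀ n, c n ∈ localLayerPointsOfEmb κ ι W n)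
    (hTr : ∀ n, 1 ≤ n → localTraceOfEmb κ ι W n (n + 1) (c (n + 1)) = ap • c n - c (n - 1))
    (col : Chroma) (z : localTowerPointsOfEmb κ ι W →+ ℤ_[p])
    (h : ∀ n k : ℕ, ∃ z' ∈ colemanKer κ ι W ap g c col, ∀ m, m = n ∨ m = n + 1 → ∀ j < p ^ m,
      (p : ℤ_[p]) ^ k ∣ evalOn W (localTowerPointsOfEmb κ ι W) z (g ^ j • c m) -
        evalOn W (localTowerPointsOfEmb κ ι W) z' (g ^ j • c m)) :
    z ∈ colemanKer κ ι W ap g c col := by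
  obtain ⟨Ls, Lf, hz⟩ := exists_isColemanPair_of_trace κ ι W hg hap hc hTr z
  suffices hL : chromaticL col Ls Lf = 0 from ⟨Ls, Lf, hz, hL⟩
  ext i
  rw [map_zero]
  refine padicInt_eq_zero_of_forall_pow_dvd fun k ↦ ?_
  obtain ⟨z', ⟨Ls', Lf', hz', hL'⟩, hag⟩ := h (2 * (i + k)) k
  have hmem : ∀ (m j : ℕ), g ^ j • c m ∈ localTowerPointsOfEmb κ ι W := fun m j ↦
    smul_mem_localTowerPointsOfEmb κ ι W _ (localLayerPointsOfEmb_le_localTowerPointsOfEmb κ ι W m (hc m))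
  have hsub : ∀ m, m = 2 * (i + k) ∨ m = 2 * (i + k) + 1 → ∀ j < p ^ m,
      (p : ℤ_[p]) ^ k ∣ evalOn W (localTowerPointsOfEmb κ ι W) (z - z') (g ^ j • c m) := by
    intro m hm j hj
    rw [evalOn_of_mem W _ _ (hmem m j), AddMonoidHom.sub_apply, ← evalOn_of_mem W _ z (hmem m j),
      ← evalOn_of_mem W _ z' (hmem m j)]
    exact hag m hm j hj
  have hk := pow_dvd_coeff_flat_of_dvd_evalOn κ ι W hap (hz.sub hz') hsub i
  have hk' : (p : ℤ_[p]) ^ min k (2 * (i + k) / 2 - i) ∣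
      PowerSeries.coeff i (chromaticL col (Ls - Ls') (Lf - Lf')) :=
    dvd_coeff_chromaticL col hk.1 hk.2
  rwa [chromaticL_sub_sub, hL', sub_zero, show 2 * (i + k) / 2 - i = k by omega, min_self] at hk'

/-! ## §3 `(Ker Col⋆)^⊥⊥ = Ker Col⋆` (either colour) -/

/-- **`(Ker Col⋆)^⊥⊥ = Ker Col⋆`** (part 17 §2 for either colour). A functional `z` on `M = E(K_∞·K_v)` such that
`p^k ∣ z(x)` whenever `p^k ∣ z'(x)` for all `z' ∈ Ker Col⋆` (i.e. `z` annihilates the `⋆`-local condition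
`E⋆_{∞,𝔭}` = the exact annihilator of `Ker Col⋆`, Def. 7.9) lies in `Ker Col⋆`: by the finite-level duality
(`SSFlatEC.exists_mem_forall_dvd_sub_of_forall_comb_dvd`) it is `p^k`-close to `Ker Col⋆` on the finite sets
`{gʲ c_m : m ∈ {n, n+1}}`, and `Ker Col⋆` is closed (§2).
[cite: Sprung2012, Def. 7.9 and Lemma 7.10 (p. 1503), Prop. 5.7 (p. 1495)]
[cite: NeukirchSchmidtWingberg2008, I §1 (1.1.8) (Pontryagin duality)] -/
theorem mem_colemanKer_of_forall_annihilator_dvd {ap : ℤ} (hap : (p : ℤ) ∣ ap)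
    {g : Field.absoluteGaloisGroup E} (hg : κ.IsTopGenerator (resGalOfEmb ι g))
    {c : ℕ → localPoints W E} (hc : ∀ n, c n ∈ localLayerPointsOfEmb κ ι W n)
    (hTr : ∀ n, 1 ≤ n → localTraceOfEmb κ ι W n (n + 1) (c (n + 1)) = ap • c n - c (n - 1))
    (col : Chroma) (z : localTowerPointsOfEmb κ ι W →+ ℤ_[p])
    (hz : ∀ (x : localTowerPointsOfEmb κ ι W) (k : ℕ),
      (∀ z' ∈ colemanKer κ ι W ap g c col, (p : ℤ_[p]) ^ k ∣ z' x) → (p : ℤ_[p]) ^ k ∣ z x) :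
    z ∈ colemanKer κ ι W ap g c col := by
  -- `Ker Col⋆` as an additive subgroup of `Hom(M, ℤ_p)`
  let Kf : AddSubgroup (localTowerPointsOfEmb κ ι W →+ ℤ_[p]) :=
    { carrier := colemanKer κ ι W ap g c col
      zero_mem' := zero_mem_colemanKer κ ι W ap g c col
      add_mem' := by
        rintro a b ⟨La, Ma, ha, ha0⟩ ⟨Lb, Mb, hb, hb0⟩
        exact ⟨La + Lb, Ma + Mb, ha.add hb, by rw [chromaticL_add_add, ha0, hb0, add_zero]⟩
      neg_mem' := by
        rintro a ⟨La, Ma, ha, ha0⟩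
        refine ⟨0 - La, 0 - Ma, ?_, ?_⟩
        · have h := (isColemanPair_zero κ ι W ap g c).sub ha
          rwa [zero_sub] at h
        · have h0 : chromaticL col (0 : IwasawaAlgebra p) 0 = 0 := by cases col <;> rfl
          rw [chromaticL_sub_sub, ha0, h0, sub_zero] }
  have hKf : ∀ w, w ∈ Kf ↔ w ∈ colemanKer κ ι W ap g c col := fun _ ↦ Iff.rfl
  have hmem : ∀ (m j : ℕ), g ^ j • c m ∈ localTowerPointsOfEmb κ ι W := fun m j ↦
    smul_mem_localTowerPointsOfEmb κ ι W _ (localLayerPointsOfEmb_le_localTowerPointsOfEmb κ ι W m (hc m))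
  refine mem_colemanKer_of_forall_exists_agree κ ι W hap hg hc hTr col z fun n k ↦ ?_
  -- the finite test family `(b, j) ↦ gʲ c_{n+b}`, `j < p^{n+1}`
  let x : Bool × Fin (p ^ (n + 1)) → localTowerPointsOfEmb κ ι W := fun bj ↦
    ⟨g ^ (bj.2 : ℕ) • c (if bj.1 then n + 1 else n), hmem _ _⟩
  obtain ⟨z', hz'K, hz'⟩ := exists_mem_forall_dvd_sub_of_forall_comb_dvd Kf x k z
    (fun nv hK ↦ hz _ k fun w hw ↦ hK w ((hKf w).mpr hw))
  refine ⟨z', (hKf z').mp hz'K, fun m hm j hj ↦ ?_⟩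
  have hjlt : j < p ^ (n + 1) := by
    rcases hm with rfl | rfl
    · exact lt_of_lt_of_le hj (Nat.pow_le_pow_right (Fact.out : p.Prime).pos (Nat.le_succ _))
    · exact hj
  rw [evalOn_of_mem W _ z (hmem m j), evalOn_of_mem W _ z' (hmem m j)]
  rcases hm with rfl | rfl
  · exact hz' (false, ⟨j, hjlt⟩)
  · exact hz' (true, ⟨j, hjlt⟩)

/-! ## §4 `(E⋆_{∞,𝔭})_Γ = 0` in pair form (either colour) -/

/-- **`(E⋆_{∞,𝔭})_Γ = 0` in pair form** (part 18 for either colour). Let `M = E(K_∞·K_v)` (no `p`-torsion),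
`K = Ker Col⋆ ⊆ Hom(M, ℤ_p)` for local data `(g, c)` (`p ∣ a_p`, `g` restricting to a topological generator,
levels, `n ≥ 1` trace relation). If `(x, k)` is annihilated by `K` (`p^k ∣ z(x)` for all `z ∈ K` — the class
`x ⊗ p^{-k}` lies in `E⋆_{∞,𝔭}`), then there are `(x', k')` annihilated by `K` and `m ∈ M` with
`p^{k'}·x − p^k·(g⁻¹x' − x') = p^{k+k'}·m` — i.e. `x ⊗ p^{-k} = (g⁻¹ − 1)·(x' ⊗ p^{-k'})` in `M ⊗ ℚ_p/ℤ_p`: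
the `Γ`-coinvariants of `E⋆_{∞,𝔭}` vanish. Proof verbatim from `SSFlatEC.flatAnnihilator_twist_divisible`
(Pontryagin duality; `ℚ/ℤ` injective; biduality `K^⊥⊥ = K` of §3; twist-saturation of §1).
[cite: Sprung2012, Def. 7.9, Lemma 7.10 (p. 1503), Prop. 5.7 (p. 1495), §2 p. 1486]
[cite: NeukirchSchmidtWingberg2008, I §1 (1.1.8) (Pontryagin duality)] -/
theorem annihilator_twist_divisible {ap : ℤ} (hap : (p : ℤ) ∣ ap)
    {g : Field.absoluteGaloisGroup E} (hg : κ.IsTopGenerator (resGalOfEmb ι g))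
    {c : ℕ → localPoints W E} (hc : ∀ n, c n ∈ localLayerPointsOfEmb κ ι W n)
    (hTr : ∀ n, 1 ≤ n → localTraceOfEmb κ ι W n (n + 1) (c (n + 1)) = ap • c n - c (n - 1))
    (hnt : ∀ P ∈ localTowerPointsOfEmb κ ι W, p • P = 0 → P = 0) (col : Chroma)
    (x : localTowerPointsOfEmb κ ι W) (k : ℕ)
    (hx : ∀ z ∈ colemanKer κ ι W ap g c col, (p : ℤ_[p]) ^ k ∣ z x) :
    ∃ (x' : localTowerPointsOfEmb κ ι W) (k' : ℕ) (m : localTowerPointsOfEmb κ ι W),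
      (∀ z ∈ colemanKer κ ι W ap g c col, (p : ℤ_[p]) ^ k' ∣ z x') ∧
      p ^ k' • x - p ^ k • ((⟨g⁻¹ • (x' : localPoints W E), smul_mem_localTowerPointsOfEmb κ ι W g⁻¹ x'.2⟩ :
          localTowerPointsOfEmb κ ι W) - x') = p ^ (k + k') • m := by
  -- notation: `ℳ = E(K_∞·K_v)`, `𝓗 = Hom(ℳ, ℤ_p)`, the kernel `Kset = Ker Col⋆`
  set Kset : Set (localTowerPointsOfEmb κ ι W →+ ℤ_[p]) := colemanKer κ ι W ap g c col with hKset
  -- the twist `σ : y ↦ g⁻¹ y` on `ℳ`, `τ : z ↦ z ∘ σ` on `𝓗`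
  let σ : localTowerPointsOfEmb κ ι W →+ localTowerPointsOfEmb κ ι W :=
    { toFun := fun y ↦ ⟨g⁻¹ • (y : localPoints W E), smul_mem_localTowerPointsOfEmb κ ι W g⁻¹ y.2⟩
      map_zero' := Subtype.ext (by simp)
      map_add' := fun a b ↦ Subtype.ext (by simp [smul_add]) }
  have hσ : ∀ y : localTowerPointsOfEmb κ ι W,
      σ y = ⟨g⁻¹ • (y : localPoints W E), smul_mem_localTowerPointsOfEmb κ ι W g⁻¹ y.2⟩ := fun _ ↦ rfl
  let τ : (localTowerPointsOfEmb κ ι W →+ ℤ_[p]) →+ (localTowerPointsOfEmb κ ι W →+ ℤ_[p]) :=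
    AddMonoidHom.compHom' σ
  have hτ : ∀ (z : localTowerPointsOfEmb κ ι W →+ ℤ_[p]) (y : localTowerPointsOfEmb κ ι W),
      τ z y = z ⟨g⁻¹ • (y : localPoints W E), smul_mem_localTowerPointsOfEmb κ ι W g⁻¹ y.2⟩ := fun _ _ ↦ rfl
  -- `K` is twist-stable and twist-saturated (§1)
  have hKτ : ∀ z ∈ Kset, τ z ∈ Kset := fun z hz ↦
    (mem_colemanKer_twist_iff κ ι W hap hg hc hTr col (z := z) (z' := τ z) (hτ z)).mpr hz
  have hKsat : ∀ z, τ z - z ∈ Kset → z ∈ Kset := fun z hz ↦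
    mem_colemanKer_of_twist_sub_mem κ ι W hap hg hc hTr col (z := z) (z' := τ z) (hτ z) hz
  -- the pairing characters `e y j = (z ↦ z(y)/p^j)` and their group `D ≅ ℳ ⊗ ℚ_p/ℤ_p`
  obtain ⟨e, he⟩ := exists_padicPairingFamily (N := localTowerPointsOfEmb κ ι W) (p := p)
  obtain ⟨D, hD⟩ := exists_addSubgroup_padicPairingFamily he
  have heD : ∀ y j, e y j ∈ D := fun y j ↦ (hD _).mpr ⟨y, j, rfl⟩
  have he0 : ∀ y j z, e y j z = 0 ↔ (p : ℤ_[p]) ^ j ∣ z y := fun y j z ↦ padicPairingFamily_apply_eq_zero_iff he y j z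
  -- the twist `A d = d ∘ τ` on characters, `A (e y j) = e (σ y) j`
  let A : ((localTowerPointsOfEmb κ ι W →+ ℤ_[p]) →+ AddCircle (1 : ℚ)) →+
      ((localTowerPointsOfEmb κ ι W →+ ℤ_[p]) →+ AddCircle (1 : ℚ)) := AddMonoidHom.compHom' τ
  have hA : ∀ d z, A d z = d (τ z) := fun _ _ ↦ rfl
  have hAe : ∀ y j, A (e y j) = e (σ y) j := by
    intro y j
    ext z
    obtain ⟨a, ha⟩ := ZMod.intCast_surjective (PadicInt.toZModPow j (z (σ y)))
    rw [hA, he y j (τ z) a (by rw [hτ, ← hσ, ha]), he (σ y) j z a ha.symm]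
  -- `L = D ∩ Ann(K)` (= `E⋆_{∞,𝔭}`), stable under `A`
  let Ann : AddSubgroup ((localTowerPointsOfEmb κ ι W →+ ℤ_[p]) →+ AddCircle (1 : ℚ)) :=
    { carrier := setOf fun d ↦ ∀ z ∈ Kset, d z = 0
      zero_mem' := fun _ _ ↦ rfl
      add_mem' := fun ha hb z hz ↦ by rw [AddMonoidHom.add_apply, ha z hz, hb z hz, add_zero]
      neg_mem' := fun ha z hz ↦ by rw [AddMonoidHom.neg_apply, ha z hz, neg_zero] }
  have hAnn : ∀ d, d ∈ Ann ↔ ∀ z ∈ Kset, d z = 0 := fun _ ↦ Iff.rfl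
  let L : AddSubgroup ((localTowerPointsOfEmb κ ι W →+ ℤ_[p]) →+ AddCircle (1 : ℚ)) := D ⊓ Ann
  have hL : ∀ d, d ∈ L ↔ d ∈ D ∧ ∀ z ∈ Kset, d z = 0 := fun _ ↦ AddSubgroup.mem_inf
  have hAL : ∀ d ∈ L, A d - d ∈ L := by
    intro d hd
    obtain ⟨hdD, hdK⟩ := (hL d).mp hd
    obtain ⟨y, j, rfl⟩ := (hD _).mp hdD
    refine (hL _).mpr ⟨?_, fun z hz ↦ ?_⟩
    · rw [hAe]; exact D.sub_mem (heD _ _) (heD _ _)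
    · rw [AddMonoidHom.sub_apply, hA, hdK _ (hKτ z hz), hdK z hz, sub_zero]
  let B : L →+ L :=
    { toFun := fun d ↦ ⟨A d - d, hAL d d.2⟩
      map_zero' := Subtype.ext (by simp)
      map_add' := fun a b ↦ Subtype.ext (by
        simp only [AddSubgroup.coe_add, map_add]
        abel) }
  have hB : ∀ d : L, ((B d : L) : (localTowerPointsOfEmb κ ι W →+ ℤ_[p]) →+ AddCircle (1 : ℚ)) = A d - d :=
    fun _ ↦ rfl
  -- KEY: `B = A − 1` is onto `L` («`(E⋆_∞)_Γ = 0`», dual form)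
  have hBsurj : Function.Surjective B := by
    rw [← AddMonoidHom.range_eq_top, AddSubgroup.eq_top_iff']
    intro d₀
    by_contra hd₀
    -- a character of `L/(A−1)L` non-zero at `d₀`, pulled back to `L`
    have hne : (QuotientAddGroup.mk d₀ : L ⧸ B.range) ≠ 0 := by
      rwa [Ne, QuotientAddGroup.eq_zero_iff]
    obtain ⟨χq, hχq⟩ := CharacterModule.exists_character_apply_ne_zero_of_ne_zero hne
    let χ : L →+ AddCircle (1 : ℚ) := (χq : (L ⧸ B.range) →+ AddCircle (1 : ℚ)).comp (QuotientAddGroup.mk' B.range)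
    have hχB : ∀ d : L, χ (B d) = 0 := by
      intro d
      change (χq : (L ⧸ B.range) →+ AddCircle (1 : ℚ)) (QuotientAddGroup.mk' B.range (B d)) = 0
      rw [QuotientAddGroup.mk'_apply, (QuotientAddGroup.eq_zero_iff _).mpr (AddMonoidHom.mem_range.mpr ⟨d, rfl⟩),
        map_zero]
    have hχd₀ : χ d₀ ≠ 0 := hχq
    -- extend `χ` to `D` (`ℚ/ℤ` injective) and represent it by `w ∈ 𝓗` (biduality)
    let incl : L →+ D := AddSubgroup.inclusion inf_le_left
    obtain ⟨Φ, hΦ⟩ := CharacterModule.dual_surjective_of_injective incl.toIntLinearMap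
      (AddSubgroup.inclusion_injective inf_le_left) χ
    have hΦχ : ∀ d : L, Φ (incl d) = χ d := fun d ↦ by
      rw [← hΦ]; rfl
    obtain ⟨w, hw⟩ := exists_eval_eq_of_character_padicPairingFamily he hD Φ
    -- `χ ∘ B = 0` ⇒ every `d ∈ L` kills `τ w − w`
    have hkill : ∀ d ∈ L, d (τ w - w) = 0 := by
      intro d hd
      have h := hχB ⟨d, hd⟩
      rw [← hΦχ] at h
      have h2 : ((incl (B ⟨d, hd⟩) : D) : (localTowerPointsOfEmb κ ι W →+ ℤ_[p]) →+ AddCircle (1 : ℚ)) w = 0 :=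
        (hw _).symm.trans h
      change (A d - d) w = 0 at h2
      rwa [AddMonoidHom.sub_apply, hA, ← map_sub] at h2
    -- hence `τ w − w ∈ K^⊥⊥ = K` (§3) and `w ∈ K` (§1)
    have hτw : τ w - w ∈ Kset := by
      refine mem_colemanKer_of_forall_annihilator_dvd κ ι W hap hg hc hTr col _ fun y j hyj ↦ ?_
      have hyL : e y j ∈ L := (hL _).mpr ⟨heD y j, fun z hz ↦ (he0 y j z).mpr (hyj z hz)⟩
      exact (he0 y j _).mp (hkill _ hyL)
    have hwK : w ∈ Kset := hKsat w hτw
    -- so `χ = 0` on `L`: contradiction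
    apply hχd₀
    rw [← hΦχ]
    exact (hw _).trans (((hL _).mp d₀.2).2 w hwK)
  -- apply to `d₀ = e x k ∈ L`
  have hxL : e x k ∈ L := (hL _).mpr ⟨heD x k, fun z hz ↦ (he0 x k z).mpr (hx z hz)⟩
  obtain ⟨d', hd'⟩ := hBsurj ⟨e x k, hxL⟩
  have hd'eq : A (d' : (localTowerPointsOfEmb κ ι W →+ ℤ_[p]) →+ AddCircle (1 : ℚ)) - d' = e x k := by
    rw [← hB, hd']
  obtain ⟨hd'D, hd'K⟩ := (hL _).mp d'.2
  obtain ⟨x', k', hx'⟩ := (hD _).mp hd'D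
  refine ⟨x', k', ?_⟩
  have hann : ∀ z ∈ Kset, (p : ℤ_[p]) ^ k' ∣ z x' := fun z hz ↦ (he0 x' k' z).mp (by rw [← hx']; exact hd'K z hz)
  -- `e (σ x' − x') k' = e x k`, rescaled to the common level `k + k'`
  rw [hx', hAe] at hd'eq
  have hsub : e (σ x') k' - e x' k' = e (σ x' - x') k' := by
    rw [sub_eq_add_neg, ← padicPairingFamily_neg_left he, ← padicPairingFamily_add_left he, ← sub_eq_add_neg]
  rw [hsub] at hd'eq
  have hlev : e (p ^ k • (σ x' - x')) (k + k') = e (p ^ k' • x) (k + k') := by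
    rw [padicPairingFamily_pow_nsmul_left he, hd'eq, add_comm k k', padicPairingFamily_pow_nsmul_left he]
  rw [padicPairingFamily_eq_iff he] at hlev
  -- Pontryagin separation in `ℳ` (no `p`-torsion)
  have hN : ∀ y : localTowerPointsOfEmb κ ι W, p • y = 0 → y = 0 := fun y hy ↦
    Subtype.ext (hnt _ y.2 (by rw [← AddSubgroupClass.coe_nsmul, hy]; rfl))
  have hdvd : ∀ z : localTowerPointsOfEmb κ ι W →+ ℤ_[p],
      (p : ℤ_[p]) ^ (k + k') ∣ z (p ^ k' • x - p ^ k • (σ x' - x')) := fun z ↦ by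
    rw [← neg_sub, map_neg, dvd_neg]; exact hlev z
  obtain ⟨m, hm⟩ := exists_nsmul_eq_of_forall_addMonoidHom_padicInt_dvd hN hdvd
  refine ⟨m, hann, ?_⟩
  change p ^ k' • x - p ^ k • (σ x' - x') = p ^ (k + k') • m
  rw [hm]

end Summit.BirchSwinnertonDyer.BirchSwinnertonDyer.Theorems.SharpFlatCount

end
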